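import Summits.BirchSwinnertonDyer.BirchSwinnertonDyer.Theorems.EisensteinPrimesBSDpOnCellCStubC3RoadHFromControl
import HarnessLib

/-!
# Crux 4 `BSDpOnCellC` (stmt-BirchSwinnertonDyer-19034), line b1 (v7 `61c171a5`), stub `stub_c3`: THE KERNEL
# RESIDUAL OF ROAD H IN ONE LINE — `stub_c3` from PUBLISHED facts + the reverse divisibility
# `Fitt_Λ(X_ac^∅)·𝓞_{ℂ_p}⟦T⟧ ⊆ (Q)` at every frame + CTL-split + Keller–Yin D′ (cell `bsd-eis`, seat
# `bsd-eis-c3h` g0)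

HONEST FRAMING (cell `bsd-eis`, run/shared/lean/pub/bsd-eis/): theorems only; nothing booked; X2 stays
CONSTRUCTION-SHAPED; no label or count moves; BSD is not proved by any of this. CONDITIONAL on seven
PUBLISHED facts (conjuncts of `stub_publishedFacts`), on the REVERSE DIVISIBILITY in Fitting form at every
X2c Heegner datum and every `𝓞_{ℂ_p}`-frame `Q` (hypothesis-shaped, stated inline; this is what road H —
Keller–Yin §5.1 [PRE] + cgshw MEMO-8/9 + Cas20 §1.5 — is meant to DELIVER; not in refereed print at a
residually reducible `p ‖ N`), on CTL-split at the split pairs, and on KY D′♭ [PRE].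

## What

The honesty lemma `hidaLimitInputsIntAt_of_isTorsion_of_map_fittingIdeal_le` (p459435) showed that the
kernel content of road H's typed inputs `X2.HidaLimitInputsIntAt` is [torsion ∧ `Fitt_Λ(X_ac^∅)♭ ⊆ (Q)`];
`Theorems/…StubC3RoadHFromControl.lean` discharged the torsion clause (control theorem at ¬split,
CTL-split at split). Composing:

* **`stub_c3_of_fittingRevDivInt_of_splitControl_of_muLambdaInt`** — the registered `stub_c3` signature
  VERBATIM from [PUB ×7] + [`∀` X2c data `∀` frames `Q`: `(Fitt_Λ X_ac^∅).map ♭ ≤ (Q)`] + [CTL-split at the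
  split pairs] + [D′♭ at each sign].

So, for the census of line b1: modulo PUBLISHED facts, CTL-split (a registered stub's disjunct) and KY D′,
the IMC atom c3♭/c3s♭ over the wide receptacle is EXACTLY the one-sided reverse divisibility
"`Fitt_Λ(X_ac^∅(E[p^∞]))·𝓞_{ℂ_p}⟦T⟧ ⊆ (Q)` for every `𝓞_{ℂ_p}`-frame `Q`" — the Skinner–Urban direction of
the anticyclotomic IMC at an Eisenstein `p ‖ N`, which is what road H (Hida limit) or road R-β must supply.
What this is NOT: not a proof of that divisibility, of CTL-split, or of D′.

References: [KellerYin2024] §5.1, Thm. 5.1.3 (arXiv:2402.12781v2, PRE); [Castella2018] Thm. 2.3;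
[SkinnerUrban2014] §3.1.6; [Skinner2016PacificMC] §3.1; cell memos cgshw MEMO-8/9/10, bsd-eis-ky MEMO-2.
-/

set_option autoImplicit false
set_option linter.dupNamespace false

noncomputable section

open scoped Classical MatrixGroups ModularForm

open CongruenceSubgroup WeierstrassCurve NumberField IsDedekindDomain Field PowerSeries
  Literature.RingTheory.FittingIdeal
  Literature.NumberTheory.EllipticCurves Literature.NumberTheory.EllipticCurves.GreenbergSelmer
  Literature.NumberTheory.EllipticCurves.ModularForms
  Literature.NumberTheory.EllipticCurves.Rank1Residual
  Literature.NumberTheory.EllipticCurves.Rank1Residual.Typed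
  Literature.NumberTheory.GaloisRepresentations Literature.NumberTheory.GaloisCohomology
  Literature.NumberTheory.Automorphic
  Summit.BirchSwinnertonDyer.Rank1Residual.X11b.AcSelmer
  Summit.BirchSwinnertonDyer.Rank1Residual.X11b.Halves
  Summit.BirchSwinnertonDyer.Rank1Residual.X11b
  Summit.BirchSwinnertonDyer.Rank1Residual.X2

namespace Summit.BirchSwinnertonDyer.BirchSwinnertonDyer.Theorems

/-- **`stub_c3` (line b1 v7, crux 4 `BSDpOnCellC`) FROM [PUB ×7] + [the reverse divisibility
`Fitt_Λ(X_ac^∅)·𝓞_{ℂ_p}⟦T⟧ ⊆ (Q)` at every X2c Heegner datum and every `𝓞_{ℂ_p}`-frame] + [CTL-split at the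
split pairs] + [KELLER–YIN D′♭ at each sign].** `hfitt` is stated INLINE on the binders of
`X2.HidaLimitInputsIntAt` (no new `Prop`); torsion of `X_ac^∅` comes from `isTorsion_xAc_of_cellC_of_not_split`
(control theorem p398508, PUB inputs) resp. `isTorsion_xAc_of_splitControlOnTree` (`hCTL`); road H's typed
inputs from `hidaLimitInputsIntAt_of_isTorsion_of_map_fittingIdeal_le` (trivial member data); then
p454543's `stub_c3_of_hidaLimitInputsInt_of_muLambdaInt`. This is the ONE-LINE kernel residual of road H
for the IMC atom: the Skinner–Urban direction in Fitting form. CONDITIONAL-RESULT; nothing booked.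
[claim: KellerYin2024, status: under-review]
[cite: KellerYin2024, §5.1 and Thm. 5.1.3 = Thm. D (arXiv:2402.12781v2)] [cite: SkinnerUrban2014, §3.1.6 (p. 20)]
[cite: Castella2018, Thm. 2.3 (arXiv:1704.06608 p. 5)] -/
theorem stub_c3_of_fittingRevDivInt_of_splitControl_of_muLambdaInt
    (hGZK : rank_eq_analyticRank_of_analyticRank_le_one) (hnf : exists_isNewformOf)
    (hPT : ∀ (K : Type) [Field K] [NumberField K], poitouTate_selmerStructure_duality K)
    (hPT2 : ∀ (K : Type) [Field K] [NumberField K], poitouTate_sha_tateDual K)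
    (hEP : ∀ (K : Type) [Field K] [NumberField K] (v : HeightOneSpectrum (𝓞 K)),
      localEulerPoincareCharacteristic (v.adicCompletion K))
    (hcd : fieldCdLE_two_of_numberField)
    (hBr : ∀ (K : Type) [Field K] [NumberField K] (p : ℕ) [Fact p.Prime],
      ZpExtension.decomp_not_le_kerSubgroup_of_isAnticyclotomic K p)
    (hfitt : ∀ (W : WeierstrassCurve ℚ) [W.IsElliptic] [W.IsGloballyMinimal] (p : ℕ) [Fact p.Prime],
      CellC W p →
      ∀ (N : ℕ) [NeZero N] (K : Type) [Field K] [NumberField K] (Dt : ModularParametrizationData W N)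
        (H : HeegnerDatum N (NumberField.discr K)) (ιK : K →+* ℂ) (P : (W.baseChange K).toAffine.Point),
        CellC W p → W.conductorNorm ℤ = N →
        IsImaginaryQuadratic K → NumberField.discr K < -4 → SatisfiesHeegnerHypothesis N K →
        (W.quadraticTwist (NumberField.discr K : ℚ)).entireLFunction 1 ≠ 0 →
        WeierstrassCurve.Affine.Point.map ιK.toRatAlgHom P = heegnerPointComplex Dt H →
        ¬ (p : ℤ) ∣ Dt.c → ¬ IsOfFinAddOrder P →
        ∀ (κ : ZpExtension K p), κ.IsAnticyclotomic →
          ∀ (γ : Field.absoluteGaloisGroup K) [Fact (κ.IsTopGenerator γ)]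
            (𝔭 : HeightOneSpectrum (𝓞 K)), ((p : ℕ) : 𝓞 K) ∈ 𝔭.asIdeal →
            𝔭.asIdeal.ramificationIdx (𝓞 ℚ) = 1 → 𝔭.asIdeal.inertiaDeg (𝓞 ℚ) = 1 →
            ∀ (f : CuspForm (CongruenceSubgroup.Gamma0 N) 2), IsNewformOf W f →
              ∀ (ι' : PadicAlgCl p ≃+* ℂ),
                (∀ (w : InfinitePlace K) (k : 𝓞 K),
                  k ∈ 𝔭.asIdeal ↔ ‖ι'.symm (w.embedding (k : K))‖ < 1) →
                ∀ (ΩK : ℂ) (Ωp : ℂ_[p]) (Q : PowerSeries 𝓞_ℂ_[p]), ΩK ≠ 0 → ‖Ωp‖ = 1 →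
                  R1.IsBDPLFunctionInt p ι' 𝔭 κ γ f ΩK Ωp Q →
                    (Module.fittingIdeal (IwasawaAlgebra p) (XAc (W.baseChange K) p κ 𝔭 ∅ γ) 0).map
                        (PowerSeries.map (R1.toCpInt p)) ≤ Ideal.span {Q})
    (hCTL : ∀ (W : WeierstrassCurve ℚ) [W.IsElliptic] [W.IsGloballyMinimal] (p : ℕ) [Fact p.Prime],
      CellC W p → W.HasSplitMultiplicativeReductionAtPrime p → SplitControlOnTree W p)
    (hml : ∀ (W : WeierstrassCurve ℚ) [W.IsElliptic] [W.IsGloballyMinimal] (p : ℕ) [Fact p.Prime],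
      CellC W p → ¬ W.HasSplitMultiplicativeReductionAtPrime p → NonsplitMuLambdaOnTreeInt W p)
    (hmls : ∀ (W : WeierstrassCurve ℚ) [W.IsElliptic] [W.IsGloballyMinimal] (p : ℕ) [Fact p.Prime],
      CellC W p → W.HasSplitMultiplicativeReductionAtPrime p → SplitMuLambdaOnTreeInt W p) :
    (∀ (W : WeierstrassCurve ℚ) [W.IsElliptic] [W.IsGloballyMinimal] (p : ℕ) [Fact p.Prime],
      CellC W p → ¬ W.HasSplitMultiplicativeReductionAtPrime p → NonsplitIMCEqOnTreeInt W p) ∧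
    (∀ (W : WeierstrassCurve ℚ) [W.IsElliptic] [W.IsGloballyMinimal] (p : ℕ) [Fact p.Prime],
      CellC W p → W.HasSplitMultiplicativeReductionAtPrime p → SplitIMCEqOnTreeInt W p) := by
  refine stub_c3_of_hidaLimitInputsInt_of_muLambdaInt (fun W _ _ p _ hc => ?_) hml hmls
  refine hidaLimitInputsIntAt_of_isTorsion_of_map_fittingIdeal_le ?_
  intro N _ K _ _ Dt H ιK P hc' hN hK hd4 hHN hLt hP hcM hPinf κ hκ γ _ 𝔭 h𝔭 he hf f hfW ι' hι' ΩK Ωp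
    Q hΩK hΩp hQ
  refine ⟨?_, hfitt W p hc N K Dt H ιK P hc' hN hK hd4 hHN hLt hP hcM hPinf κ hκ γ 𝔭 h𝔭 he hf f hfW
    ι' hι' ΩK Ωp Q hΩK hΩp hQ⟩
  have hpN : p ∣ N := hN ▸ Summit.BirchSwinnertonDyer.Rank1Residual.X11b.dvd_conductorNorm_of_mult
    (W := W) hc.2.2.2
  have hsplitp : SatisfiesHeegnerHypothesis p K := fun q hq hqp => hHN q hq (hqp.trans hpN)
  by_cases hs : W.HasSplitMultiplicativeReductionAtPrime p
  · exact isTorsion_xAc_of_splitControlOnTree (hCTL W p hc hs) hc hs hK hsplitp hLt P hPinf κ hκ γ 𝔭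
      h𝔭 he hf
  · exact isTorsion_xAc_of_cellC_of_not_split hGZK hnf hPT hPT2 hEP hcd hBr hc hs hK hsplitp hLt P
      hPinf κ hκ γ 𝔭 h𝔭 he hf

end Summit.BirchSwinnertonDyer.BirchSwinnertonDyer.Theorems

end
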